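import Literature.AlgebraicGeometry.Frobenioids.Prop25Sub
import HarnessLib

/-!
# [FrdI] Proposition 2.5 (iii) / Corollary 2.6, sub-DAG rows — discharges (I): row C26-L01

Mochizuki, *The geometry of Frobenioids I: the general theory*, Kyushu J. Math. **62** (2008)
293–400, §2, Corollary 2.6, proof p. 51 ll. 5–7 [cite: MochizukiFrdI2008, Cor. 2.6 p.51]:
"the naive Frobenius functor `C → C` associated to `d` [cf. Proposition 2.1, (i)] factors naturally
through the subcategory `C(d) ⊆ C` [cf. Proposition 2.1, (ii); Definition 2.4, (iii)]; write
`Ψ₁ : C → C(d)` for the resulting functor".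
PROOF-ONLY companion of `Prop25Sub.lean` (statements, seat abc-iut-L1-t2; sub-DAG
`plan/L1/SUBDAG-FrdI-Prop25-Cor26.md` row C26-L01): the zero divisor of `Ψ₁(φ)` is `d` times a
pull-back of `Div(φ)` along a base-isomorphism (Prop. 2.1 (ii), `FrobeniusChoice.pull_div_lift`), hence
lies in `d · Φ`, so the naive Frobenius functor `naiveFrobeniusOf hF d` lifts through the wide
subcategory `C(d)` — on the nose.  No new definitions.
-/

namespace Literature.AlgebraicGeometry.Frobenioids

open CategoryTheory Opposite

namespace FrdI.P25

open PreFrobenioid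

universe w v v' u u'

variable {D : Type u} [Category.{v} D] {Φ : Dᵒᵖ ⥤ CommMonCat.{w}}
  {C : Type u'} [Category.{v'} C] (F : C ⥤ ElemFrobenioid Φ)

/-- In a Frobenioid the zero divisor of the image `φ′ = Ψ(φ)` of an arrow under the naive Frobenius
functor of degree `d` lies in `d · Φ` (Prop. 2.1 (ii): `α_A^*(Div φ′) = d · Div φ`, and `α_A` is a
base-isomorphism). [cite: MochizukiFrdI2008, Prop. 2.1(ii) p.44] -/
theorem divIn_naiveFrobeniusOf_map (hF : IsFrobenioid F) (d : ℕ+) {A B : C} (φ : A ⟶ B) :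
    divIn F (powEnd Φ d) ((naiveFrobeniusOf hF d).map φ) := by
  let ch : FrobeniusChoice F d := (nonempty_frobeniusChoice F hF d).some
  have h := hasFrobeniusLifts hF d
  haveI : IsIso (Base F (ch.hom A)) := (ch.isFrobeniusType A).2
  show Div F (ch.lift h φ) ∈ imageSubmonoid (powEnd Φ d) _
  refine ⟨pull Φ (inv (Base F (ch.hom A))) (Div F φ), ?_⟩
  rw [powEnd_app_apply, ← map_pow, ← ch.pull_div_lift h φ, ← pull_comp, IsIso.inv_hom_id, pull_id]

/-- **Row C26-L01 `NaiveFactorsThroughCd` DISCHARGED**: the naive Frobenius functor factors through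
`C(d) ⊆ C` (on the nose). [cite: MochizukiFrdI2008, Cor. 2.6 p.51] -/
theorem naiveFactorsThroughCd_holds (d : ℕ+) : NaiveFactorsThroughCd F d := fun hF =>
  ⟨{ obj := fun X => ⟨(naiveFrobeniusOf hF d).obj X⟩
     map := fun φ => ⟨(naiveFrobeniusOf hF d).map φ, divIn_naiveFrobeniusOf_map F hF d φ⟩
     map_id := fun X => WideSubcategory.hom_ext _ ((naiveFrobeniusOf hF d).map_id X)
     map_comp := fun φ ψ => WideSubcategory.hom_ext _ ((naiveFrobeniusOf hF d).map_comp φ ψ) },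
    rfl⟩

end FrdI.P25

end Literature.AlgebraicGeometry.Frobenioids
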